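import Literature.NumberTheory.CubicFields.PureCubicLatticeCodes
import Literature.Computability.Complexity.CodeFPRegs
import Literature.Algebra.EuclideanLattices.SimultaneousApproximationLLLProofs
import Literature.Algebra.EuclideanLattices.GapInstanceCodeFP
import HarnessLib

/-!
# The least cylinder element of a lattice of a pure cubic field: the program (definitions only)

Topic `NumberTheory/CubicFields`, continuation of `PureCubicLatticeCodes.lean` (codes of elements
`(x, y, z, den) ↦ (x + yθ + zθ₂)/den` and of lattices `(den, [h11, h12, h13, h22, h23, h33])` of the
pure cubic field `K = ℚ(θ)`, `θ³ = ab²`, `θ₂ = θ²/b`). For a real embedding `σ₁` and a non-real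
embedding `σ₂` of `K` and the lattice `I` of a canonical code `c` (a fractional ideal), the element
`γ ∈ I` with `σ₁ γ > 0`, `‖σ₂ γ‖ < 1` and LEAST `σ₁ γ` (the reducing element of the Buchmann–Williams
giant step; for a reduced ideal the Voronoi successor of `1`) is computed by the classical
"approximate, reduce, enumerate, filter exactly" method (Buchmann 1987 §3; Cohen GTM 138 §6.5 and
Algorithm 2.7.5):

* for every dyadic scale `X = 2ˢ`, `|s| ≤ S`, embed the basis rows `rᵢ` of `I` as
  `(σ₁ rᵢ / X, Re σ₂ rᵢ, Im σ₂ rᵢ) ∈ ℝ³`, with `σ₁ θ = ∛(ab²) =: t₁`, `σ₁ θ₂ = ∛(a²b) =: t₂`,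
  `Re σ₂(x + yθ + zθ₂) = x − (yt₁ + zt₂)/2`, `Im σ₂(…) = ±(√3/2)(yt₁ − zt₂)`; round the matrix to
  `N` binary places using the integer cube roots `⌊2ᴺ t₁⌋`, `⌊2ᴺ t₂⌋` and `⌊2ᴺ √3⌋`
  (registers; `btExprs`);
* LLL-reduce the rounded integer matrix `B̃` by the tree's machine (`lll9`, `SimApproxLLL.lllOut`),
  recover the unimodular transformation `U = B̃' adj(B̃) / det(B̃)` exactly (`uExprs`) and the new
  basis rows `R' = U H` of the SAME lattice (`rExprs`);
* enumerate the integer combinations `c' R'`, `c' ∈ [−40, 40]³` (`box`, `wExprs`): at the scale with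
  `X ≤ σ₁ γ < 2X` the coordinates of `γ` in the reduced basis are this small (LLL82 (1.7) and the
  size-reduction recursion, for a lattice whose nonzero vectors have sup norm `≥ 1/2` at that scale);
* over all scales keep the candidates in the cylinder and return one of least `σ₁` (`lexE`); all
  tests are EXACT, through the norm form `N(x + yθ + zθ₂) = x³ + ab²y³ + a²bz³ − 3abxyz`
  (`PureCubicCodes.normRow`): `sign σ₁ φ = sign N φ`, and for `σ₁ φ > 0`,
  `‖σ₂ φ‖ < 1 ↔ N(φ) < σ₁ φ ↔ N(φ − N φ) > 0`.

Arithmetic is written in the register-expression language `RegProg.Ex` of `CodeFPRegs.lean`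
(so that polynomial time is structural); the budget `N = 16L + 64` and the scan half-width
`S = 3L + 8` are read off the length `L` of the input code. This file holds ONLY the definitions;
the polynomial-time realisation and the correctness theorem are theorem-only sequels
(`PureCubicLexMinFP.lean`, `PureCubicLexMin*.lean`).

Register layouts (all register files are `List ℤ`):
* `regs0 = [a, b, den, h11, h12, h13, h22, h23, h33, s, N, T1, T2, S3]` (`T1 = ⌊2ᴺ∛(ab²)⌋`,
  `T2 = ⌊2ᴺ∛(a²b)⌋`, `S3 = ⌊2ᴺ√3⌋`);
* `B̃ ++ B̃'` (row-major, `18` registers) for `uExprs`; `U ++ [h11, …, h33]` (`15`) for `rExprs`;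
  `c' ++ R'` (`12`) for `wExprs`; `w ++ [a, b, den]` and `w' ++ w ++ [a, b]` for the exact tests.

## References

* J. Buchmann, *On the computation of units and class numbers by a generalization of Lagrange's
  algorithm*, J. Number Theory 26 (1987) 8–30, §3. [folklore]
* H. Cohen, *A Course in Computational Algebraic Number Theory*, GTM 138, Springer 1993, §2.6–2.7
  (LLL, Fincke–Pohst enumeration), §6.5. [Cohen1993]
* A. K. Lenstra, H. W. Lenstra, L. Lovász, Math. Ann. 261 (1982), Prop. 1.6, 1.26.
  [LenstraLenstraLovasz1982]
-/

namespace Literature.NumberTheory.CubicFields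

namespace PureCubicLexMin

open Literature.Computability.Complexity Literature.Computability.Complexity.CodeFP
  Literature.Computability.Complexity.RegProg Literature.Computability.Complexity.LMat
  Literature.Algebra.EuclideanLattices Literature.Algebra.EuclideanLattices.GapCodes

/-! ### Register expressions: the rounded embedding matrix -/

/-- `2ᴺ` (register `10` holds the budget `N`, which is also the exponent cap). [folklore] -/
def powN : Ex := .pow2 (.reg 10)

/-- `2^{|s|}` (register `9` holds the scale exponent `s`, `|s| ≤ N`). [folklore] -/
def powS : Ex := .pow2 (.abs (.reg 9))

/-- `x·2ᴺ + y·T1 + z·T2 ≈ 2ᴺ (x + y t₁ + z t₂) = 2ᴺ σ₁(x + yθ + zθ₂)`. [folklore] -/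
def linA (x y z : Ex) : Ex := .add (.add (.mul x powN) (.mul y (.reg 11))) (.mul z (.reg 12))

/-- First column: `⌊2ᴺ σ₁(r) / 2ˢ⌋` for the row `r = (x + yθ + zθ₂)/den` (two cases on the sign
of `s`). [folklore] -/
def col1 (x y z : Ex) : Ex :=
  .ite (.lt (.reg 9) (.cst 0)) (.ediv (.mul (linA x y z) powS) (.reg 2))
    (.ediv (linA x y z) (.mul (.reg 2) powS))

/-- Second column: `⌊2ᴺ Re σ₂(r)⌋ = ⌊2ᴺ (x − (yt₁ + zt₂)/2)/den⌋`. [folklore] -/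
def col2 (x y z : Ex) : Ex :=
  .ediv (.sub (.sub (.mul (.cst 2) (.mul x powN)) (.mul y (.reg 11))) (.mul z (.reg 12)))
    (.mul (.cst 2) (.reg 2))

/-- Third column: `⌊2ᴺ (√3/2)(yt₁ − zt₂)/den⌋` (up to the sign of `Im σ₂ θ`). [folklore] -/
def col3 (y z : Ex) : Ex :=
  .ediv (.mul (.reg 13) (.sub (.mul y (.reg 11)) (.mul z (.reg 12))))
    (.mul (.mul (.cst 2) (.reg 2)) powN)

/-- The three entries of the rounded embedding of one coordinate row. [folklore] -/
def rowExprs (x y z : Ex) : List Ex := [col1 x y z, col2 x y z, col3 y z]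

/-- **The rounded scaled embedding matrix `B̃`** (row-major) of the three basis rows
`(h11, h12, h13)`, `(0, h22, h23)`, `(0, 0, h33)` of a lattice code, on `regs0`. [cite: Cohen1993, §6.5] -/
def btExprs : List Ex :=
  rowExprs (.reg 3) (.reg 4) (.reg 5) ++ rowExprs (.cst 0) (.reg 6) (.reg 7) ++
    rowExprs (.cst 0) (.cst 0) (.reg 8)

/-! ### Register expressions: exact `3 × 3` linear algebra -/

/-- Entry `(i, j)` of the row-major `3 × 3` block of registers starting at `o`. [folklore] -/
def mat (o : ℕ) (i j : ℕ) : Ex := .reg (o + 3 * i + j)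

/-- The determinant of a `3 × 3` matrix of expressions (cofactor expansion along row `0`). [folklore] -/
def det3 (m : ℕ → ℕ → Ex) : Ex :=
  .add (.sub (.mul (m 0 0) (.sub (.mul (m 1 1) (m 2 2)) (.mul (m 1 2) (m 2 1))))
      (.mul (m 0 1) (.sub (.mul (m 1 0) (m 2 2)) (.mul (m 1 2) (m 2 0)))))
    (.mul (m 0 2) (.sub (.mul (m 1 0) (m 2 1)) (.mul (m 1 1) (m 2 0))))

/-- The adjugate of a `3 × 3` matrix of expressions: `adj(A)ᵢⱼ = A_{j+1,i+1} A_{j+2,i+2} −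
A_{j+1,i+2} A_{j+2,i+1}` (indices mod `3`; Mathlib `Matrix.adjugate_fin_three`). [folklore] -/
def adj3 (m : ℕ → ℕ → Ex) (i j : ℕ) : Ex :=
  .sub (.mul (m ((j + 1) % 3) ((i + 1) % 3)) (m ((j + 2) % 3) ((i + 2) % 3)))
    (.mul (m ((j + 1) % 3) ((i + 2) % 3)) (m ((j + 2) % 3) ((i + 1) % 3)))

/-- Entry `(i, j)` of `U = B̃' · adj(B̃) / det(B̃)` on the register file `B̃ ++ B̃'` (exact when
`B̃' = U B̃` with `U` integral and `det B̃ ≠ 0`). [folklore] -/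
def uEntry (i j : ℕ) : Ex :=
  .ediv (.add (.add (.mul (mat 9 i 0) (adj3 (mat 0) 0 j)) (.mul (mat 9 i 1) (adj3 (mat 0) 1 j)))
    (.mul (mat 9 i 2) (adj3 (mat 0) 2 j))) (det3 (mat 0))

/-- **The transformation matrix `U`** (row-major) on `B̃ ++ B̃'`. [folklore] -/
def uExprs : List Ex :=
  [uEntry 0 0, uEntry 0 1, uEntry 0 2, uEntry 1 0, uEntry 1 1, uEntry 1 2,
    uEntry 2 0, uEntry 2 1, uEntry 2 2]

/-- The upper triangular matrix `H` of a lattice code, entries read from the registers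
`9, …, 14` of the file `U ++ [h11, h12, h13, h22, h23, h33]`. [folklore] -/
def hReg : ℕ → ℕ → Ex
  | 0, 0 => .reg 9
  | 0, 1 => .reg 10
  | 0, 2 => .reg 11
  | 1, 1 => .reg 12
  | 1, 2 => .reg 13
  | 2, 2 => .reg 14
  | _, _ => .cst 0

/-- Entry `(i, j)` of `R' = U · H` (the numerators of the new basis rows). [folklore] -/
def rEntry (i j : ℕ) : Ex :=
  .add (.add (.mul (mat 0 i 0) (hReg 0 j)) (.mul (mat 0 i 1) (hReg 1 j))) (.mul (mat 0 i 2) (hReg 2 j))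

/-- **The new basis numerators `R' = U H`** (row-major) on `U ++ [h11, …, h33]`. [folklore] -/
def rExprs : List Ex :=
  [rEntry 0 0, rEntry 0 1, rEntry 0 2, rEntry 1 0, rEntry 1 1, rEntry 1 2,
    rEntry 2 0, rEntry 2 1, rEntry 2 2]

/-- Coordinate `j` of `c' R'` on the register file `c' ++ R'`. [folklore] -/
def wEntry (j : ℕ) : Ex :=
  .add (.add (.mul (.reg 0) (mat 3 0 j)) (.mul (.reg 1) (mat 3 1 j))) (.mul (.reg 2) (mat 3 2 j))

/-- **The candidate row `c' R'`** on `c' ++ R'`. [folklore] -/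
def wExprs : List Ex := [wEntry 0, wEntry 1, wEntry 2]

/-- **The enumeration box** `[−40, 40]³` (as coefficient rows). [cite: Cohen1993, Algorithm 2.7.5] -/
def box : List (List ℤ) :=
  (List.range 81).flatMap fun i => (List.range 81).flatMap fun j => (List.range 81).map fun k =>
    [(i : ℤ) - 40, (j : ℤ) - 40, (k : ℤ) - 40]

/-! ### Register expressions: the exact tests -/

/-- The cube of an expression. [folklore] -/
def cubeE (e : Ex) : Ex := .mul e (.mul e e)

/-- **The norm form** `x³ + ab²y³ + a²bz³ − 3ab·xyz` as an expression
(`PureCubicCodes.normRow`). [cite: Cohen1993, §6.4.5] -/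
def normEx (x y z a b : Ex) : Ex :=
  .sub (.add (.add (cubeE x) (.mul (.mul a (.mul b b)) (cubeE y))) (.mul (.mul (.mul a a) b) (cubeE z)))
    (.mul (.mul (.mul (.mul (.cst 3) a) b) x) (.mul y z))

/-- `N(w)` on the register file `w ++ [a, b, den]`. [folklore] -/
def nrmW : Ex := normEx (.reg 0) (.reg 1) (.reg 2) (.reg 3) (.reg 4)

/-- `N(den² w − (N(w), 0, 0))` on `w ++ [a, b, den]`: for `φ = w/den` with `σ₁ φ > 0` its sign is
that of `σ₁(φ − N φ)`, positive iff `‖σ₂ φ‖ < 1`. [folklore] -/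
def cylW : Ex :=
  normEx (.sub (.mul (.mul (.reg 5) (.reg 5)) (.reg 0)) nrmW) (.mul (.mul (.reg 5) (.reg 5)) (.reg 1))
    (.mul (.mul (.reg 5) (.reg 5)) (.reg 2)) (.reg 3) (.reg 4)

/-- `N(w' − w)` on `w' ++ w ++ [a, b]`: negative iff `σ₁(w'/den) < σ₁(w/den)`. [folklore] -/
def ltW : Ex :=
  normEx (.sub (.reg 0) (.reg 3)) (.sub (.reg 1) (.reg 4)) (.sub (.reg 2) (.reg 5)) (.reg 6) (.reg 7)

/-! ### The real embedding data (specification vocabulary) -/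

/-- `t₁ = ∛(ab²) = σ₁ θ` for the real embedding `σ₁`. [folklore] -/
noncomputable def t1 (a b : ℕ) : ℝ := ((a * b ^ 2 : ℕ) : ℝ) ^ (1 / 3 : ℝ)

/-- `t₂ = ∛(a²b) = σ₁ θ₂`, `θ₂ = θ²/b`. [folklore] -/
noncomputable def t2 (a b : ℕ) : ℝ := ((a ^ 2 * b : ℕ) : ℝ) ^ (1 / 3 : ℝ)

/-- **The scaled embedding of a coordinate row** `r = (x + yθ + zθ₂)/den` at scale `X`:
`(σ₁ r / X, Re σ₂ r, ± Im σ₂ r) = ((x + yt₁ + zt₂)/(den X), (x − (yt₁ + zt₂)/2)/den,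
(√3/2)(yt₁ − zt₂)/den)`. [folklore] -/
noncomputable def embRow (t₁ t₂ X : ℝ) (den : ℕ) (x y z : ℤ) : Fin 3 → ℝ :=
  ![((x : ℝ) + y * t₁ + z * t₂) / (den * X), ((x : ℝ) - (y * t₁ + z * t₂) / 2) / den,
    Real.sqrt 3 / 2 * (y * t₁ - z * t₂) / den]

/-- **The scaled embedding matrix `B_X`** of the lattice code `(den, [h11, h12, h13, h22, h23, h33])`:
its rows are the scaled embeddings of the basis rows `(h11, h12, h13)`, `(0, h22, h23)`,
`(0, 0, h33)`; the integer matrix `btExprs` approximates `2ᴺ B_X` entrywise. [cite: Cohen1993, §6.5] -/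
noncomputable def embMatrix (t₁ t₂ X : ℝ) (den : ℕ) (hs : List ℤ) : Matrix (Fin 3) (Fin 3) ℝ :=
  Matrix.of ![embRow t₁ t₂ X den (hs.getD 0 0) (hs.getD 1 0) (hs.getD 2 0),
    embRow t₁ t₂ X den 0 (hs.getD 3 0) (hs.getD 4 0), embRow t₁ t₂ X den 0 0 (hs.getD 5 0)]

/-! ### The program -/

/-- The code of an input `((a, b), (den, [h11, …, h33]))`. [folklore] -/
abbrev inE : (ℕ × ℕ) × (ℕ × List ℤ) → List Bool := pairE (pairE natE natE) (pairE natE (rawE intE))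

/-- **The initial register file** at scale exponent `s` with budget `N`:
`[a, b, den, h11, …, h33, s, N, ⌊2ᴺ∛(ab²)⌋, ⌊2ᴺ∛(a²b)⌋, ⌊2ᴺ√3⌋]`. [folklore] -/
def regs0 (inp : (ℕ × ℕ) × (ℕ × List ℤ)) (N : ℕ) (s : ℤ) : List ℤ :=
  [(inp.1.1 : ℤ), (inp.1.2 : ℤ), (inp.2.1 : ℤ)] ++ inp.2.2 ++
    [s, (N : ℤ), (Nat.nthRoot 3 (inp.1.1 * inp.1.2 ^ 2 * 8 ^ N) : ℤ),
      (Nat.nthRoot 3 (inp.1.1 ^ 2 * inp.1.2 * 8 ^ N) : ℤ), (Nat.sqrt (3 * 4 ^ N) : ℤ)]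

/-- **The LLL stage**: the row-major entries of the tree's LLL machine output
(`SimApproxLLL.lllOut`, LLL82 with `δ = 3/4`) on the `3 × 3` integer matrix with row-major entries
`bt`. [cite: LenstraLenstraLovasz1982, Prop. 1.26] -/
noncomputable def lll9 (bt : List ℤ) : List ℤ :=
  SimApproxLLL.flatOf (SimApproxLLL.lllOut ⟨3, toMat 3 3 (rowsOfFlat 3 bt)⟩)

/-- **The candidate rows at one scale**: `c' R'` for `c'` in the box, `R' = U H`,
`U = B̃' adj(B̃)/det(B̃)`, `B̃' = LLL(B̃)`, `B̃` the rounded scaled embedding matrix.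
[cite: Cohen1993, §6.5] -/
noncomputable def perScale (inp : (ℕ × ℕ) × (ℕ × List ℤ)) (N : ℕ) (s : ℤ) : List (List ℤ) :=
  let bt := btExprs.map (Ex.eval N (regs0 inp N s))
  let u := uExprs.map (Ex.eval 0 (bt ++ lll9 bt))
  let r := rExprs.map (Ex.eval 0 (u ++ inp.2.2))
  box.map fun c => wExprs.map (Ex.eval 0 (c ++ r))

/-- The budget `N = 16L + 64`, `L` the length of the input code (precision of the rounding, exponent
cap, and size of all intermediate integers). [folklore] -/
def budget (inp : (ℕ × ℕ) × (ℕ × List ℤ)) : ℕ := 16 * (inE inp).length + 64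

/-- The scan half-width `S = 3L + 8`: the scale `2ˢ ≤ σ₁ γ < 2ˢ⁺¹` has `|s| ≤ S`. [folklore] -/
def halfWidth (inp : (ℕ × ℕ) × (ℕ × List ℤ)) : ℕ := 3 * (inE inp).length + 8

/-- **All candidate rows**, over the scales `s ∈ [−S, S]`. [cite: Cohen1993, §6.5] -/
noncomputable def allCands (inp : (ℕ × ℕ) × (ℕ × List ℤ)) : List (List ℤ) :=
  ((List.range (2 * halfWidth inp + 1)).map fun k =>
    perScale inp (budget inp) ((k : ℤ) - halfWidth inp)).flatten

/-- **The exact cylinder test** on a candidate row `w` (value `φ = w/den`): `N(φ) > 0` and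
`N(φ − N(φ)) > 0`, i.e. `σ₁ φ > 0` and `‖σ₂ φ‖ < 1`. [folklore] -/
def inCyl (inp : (ℕ × ℕ) × (ℕ × List ℤ)) (w : List ℤ) : Bool :=
  decide (0 < nrmW.eval 0 (w ++ [(inp.1.1 : ℤ), (inp.1.2 : ℤ), (inp.2.1 : ℤ)])) &&
    decide (0 < cylW.eval 0 (w ++ [(inp.1.1 : ℤ), (inp.1.2 : ℤ), (inp.2.1 : ℤ)]))

/-- **The exact comparison** `σ₁(w'/den) < σ₁(w/den)`, i.e. `N(w' − w) < 0`. [folklore] -/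
def isLt (inp : (ℕ × ℕ) × (ℕ × List ℤ)) (w' w : List ℤ) : Bool :=
  decide (ltW.eval 0 (w' ++ w ++ [(inp.1.1 : ℤ), (inp.1.2 : ℤ)]) < 0)

/-- The candidates in the cylinder. [folklore] -/
noncomputable def validCands (inp : (ℕ × ℕ) × (ℕ × List ℤ)) : List (List ℤ) :=
  (allCands inp).filter (inCyl inp)

/-- The candidates in the cylinder of least real conjugate. [folklore] -/
noncomputable def minCands (inp : (ℕ × ℕ) × (ℕ × List ℤ)) : List (List ℤ) :=
  (validCands inp).filter fun w => (validCands inp).all fun w' => !isLt inp w' w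

/-- **The program `lexE`**: the element code `(x, y, z, den)` of the cylinder element of least real
conjugate of the lattice of the input code (junk `(0, 0, 0, 1)` if no candidate survives, which does
not happen on canonical codes of fractional ideals). [cite: Cohen1993, §6.5] -/
noncomputable def lexE (inp : (ℕ × ℕ) × (ℕ × List ℤ)) : ℤ × ℤ × ℤ × ℕ :=
  match minCands inp with
  | [] => (0, 0, 0, 1)
  | w :: _ => (w.getD 0 0, w.getD 1 0, w.getD 2 0, inp.2.1)

end PureCubicLexMin

end Literature.NumberTheory.CubicFields
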